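/-
Copyright: the b2b-balaban T⁴-continuum CRUX team, row NE7b OWNER lineage `t4-ne7b-p1` (gen 142). Project licence.
-/
import Summits.QuantumFields.BalabanUV.T4Continuum.Spine.NE7b.SupHessWDerivFDeriv
import Summits.QuantumFields.BalabanUV.T4Continuum.Spine.NE7b.SupKernelSchurQuadrilinear
import Summits.QuantumFields.BalabanUV.T4Continuum.Spine.NE7b.SupWhitenedFourthKernelEntry
import Summits.QuantumFields.BalabanUV.T4Continuum.Spine.NE7b.SupKernelClassFourthLetters

/-!
# THE OPERATOR LETTER `κ₄⁺` OF THE FLUCTUATION STEP'S FOURTH DERIVATIVE, GENERAL `Γ = AAᵀ` (the order-4 block of the kernel-letter CLASS MAP —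
# THE END).  (533): the third derivative `T(ψ)` of the next potential `W = −log∫e^{−U(ω+ψ)}dN(0,AAᵀ)` is Fréchet-differentiable in `ψ` with
# derivative `Q(ψ) = Σ_{x,y,z}(fderiv of the entry)·B_{xyz}`, a continuous linear map into trilinear maps — i.e. the FOURTH derivative as a
# `4`-linear map `(m,h,k,l) ↦ Q(ψ)[m][h,k,l]`, differentiation direction first — whose entries `Q(ψ)[e_x][e_y,e_z,e_t]` are (521)'s centred display;
# (526) bounds those entries by the background-free majorant `M_{xyzt}`; (531) sums `M` with the third and the fourth slot fixed (`k4s2⁺`,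
# `k4s3⁺`); (530) reads the operator norm off two slot letters.  Hence
#   `‖Q(ψ)‖ ≤ √(k4s2⁺ · k4s3⁺)`   UNIFORMLY IN THE BACKGROUND `ψ` AND THE VOLUME
# — the operator letter of `∂⁴W` for the road's SINGULAR finite-range `Γ = AAᵀ` in the input's letters of orders two–four, the factor's letters,
# the admissible `D`'s letters, the geometry letters and the smallness.  With (484) (order 2), (483) (order 3), (526)∕(531) (order-4 entry format
# and letters) this CLOSES the kernel-letter class map through order four (row NE7b, node U5c; (533), (530), (526), (531) BY NAME; [folklore])

Cell `pub-balaban`, sub-cell `t4`, spine estimate NE7b (`T4WeightBudget.RelWeightBound`; the cell's OWN estimate — NOT PRINTED in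
[Bałaban 1983–89], NOT PROVED).  Crux-route work under `Spine/NE7b/` by the row OWNER (`t4-ne7b-p1` gen 142, file (534)) under FREEZE
(0)'s crux-prover clause; NOTHING of Bałaban's is named as a Lean object, valued or asserted; no `T4Continuum/Support` leaf typed; no
`def`, no notation (`Q(ψ)` and the letters WRITTEN OUT); zero `sorry`.  Imports (BY NAME): the OWNER's (533) `…SupHessWDerivFDeriv`
(`third_form_clm_fderiv_entry`), (530) `…SupKernelSchurQuadrilinear` (`opNorm_le_of_slot_letters_four`), (526) `…SupWhitenedFourthKernelEntry`
(`whitened_fourth_kernel_entry`), (531) `…SupKernelClassFourthLetters` (`output_k4s2`, `output_k4s3`); (458) `posSemidef_AAT` through them.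

WHAT IS PROVED ([folklore]): THE END **`fourth_order_operator_letter`**; §2 toy.

HONEST (what this is NOT).  The operator letter grows per step before rescaling ((433)∕(436) bookkeeping; the FLOW is NOT claimed); the weights,
`D`'s letters, the profile letters and the site∕support letters are hypotheses (discharged for a finite-range factor by (476)∕(485)∕(499)∕(510)∕(524));
continuity of `Q` in `ψ` (hence `W ∈ C⁴` in the classical sense) is NOT typed; ORDER FIVE NOT typed.  Scalar skeleton ((A3), NC-NE7b-α UNRULED);
nothing of Bałaban's asserted.  BY-NAME EFFECT ON THE WALL: NONE.  NE7b NOT PRINTED ∕ NOT PROVED; spine PROVED 0∕9; rung (B)+1 — the programme's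
measures remain FINITE-torus statements; NOT the mass gap, NOT Clay.  HONEST DEPENDENCY: continuum YM on T⁴ ⇐ BetaPertH ∧ nine spine estimates
(0∕9 proved); BetaPertH ⇐ (D1) ∧ (D4) ∧ CAP+tail; G-an2-4 gates asym, D1 and NE2∕3∕4.
-/

set_option autoImplicit false
set_option maxSynthPendingDepth 3

noncomputable section

namespace Summit.QuantumFields.BalabanUV.T4Continuum.NE7b.SupFourthOrderOperatorLetter

open MeasureTheory ProbabilityTheory Finset Real Matrix
open scoped BigOperators Matrix
open SupWhitenedMomentLetters (posSemidef_AAT)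
open SupHessWDerivFDeriv (third_form_clm_fderiv_entry)
open SupKernelSchurQuadrilinear (opNorm_le_of_slot_letters_four)
open SupWhitenedFourthKernelEntry (whitened_fourth_kernel_entry)
open SupKernelClassFourthLetters (output_k4s2 output_k4s3)

variable {ι κ : Type} [Fintype ι] [DecidableEq ι] [Fintype κ] [DecidableEq κ]

section TheEnd

variable {U : EuclideanSpace ℝ ι → ℝ} {U' : EuclideanSpace ℝ ι → EuclideanSpace ℝ ι →L[ℝ] ℝ}
  {U'' : EuclideanSpace ℝ ι → EuclideanSpace ℝ ι →L[ℝ] EuclideanSpace ℝ ι →L[ℝ] ℝ}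
  {U₃ : EuclideanSpace ℝ ι → EuclideanSpace ℝ ι →L[ℝ] EuclideanSpace ℝ ι →L[ℝ] EuclideanSpace ℝ ι →L[ℝ] ℝ}
  {U₄ : EuclideanSpace ℝ ι → EuclideanSpace ℝ ι →L[ℝ] EuclideanSpace ℝ ι →L[ℝ] EuclideanSpace ℝ ι →L[ℝ] EuclideanSpace ℝ ι →L[ℝ] ℝ}
  {Hk : ι → ι → ℝ} {K3 : ι → ι → ι → ℝ} {K4 : ι → ι → ι → ι → ℝ} {A : Matrix ι κ ℝ} {D : κ → κ → ℝ}
  {γop κ₀ κ₁ κ₂ κ₃ κ₄ a τ δ θp lam lamA αr αc hr hc k3r k3c k3m k4r k4c k4s2 k4s3 γ dr dc dθ dθ' αθ βθ S S' : ℝ} {θ : κ → κ → ℝ} {σ : ι → κ → ℝ}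
  {ρ r : ι → ι → ℝ} {n : ℕ}

set_option maxHeartbeats 400000 in
/-- **THE END — THE OPERATOR LETTER OF THE FOURTH DERIVATIVE, GENERAL `Γ = AAᵀ`**: `‖Q(ψ)‖ ≤ √(k4s2⁺·k4s3⁺)` with the two slot letters written out
in the input's letters, uniformly in the background and the volume. [folklore] -/
theorem fourth_order_operator_letter [Nonempty κ] (hΓop : (γop • (1 : Matrix ι ι ℝ) - A * Aᵀ).PosSemidef) (Y : Finset ι)
    (hUd : ∀ φ : EuclideanSpace ℝ ι, HasFDerivAt U (U' φ) φ) (hU'd : ∀ φ : EuclideanSpace ℝ ι, HasFDerivAt U' (U'' φ) φ)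
    (hU''d : ∀ φ : EuclideanSpace ℝ ι, HasFDerivAt U'' (U₃ φ) φ) (hU₃d : ∀ φ : EuclideanSpace ℝ ι, HasFDerivAt U₃ (U₄ φ) φ) (hU₄c : Continuous U₄)
    (hκ₀ : 0 ≤ κ₀) (hκ₁ : 0 ≤ κ₁) (ha : 0 ≤ a) (hτ : 0 < τ) (hδ : 0 < δ) (hθ0 : 0 < θp) (hθ1 : θp < 1)
    (hκθ : (2 * κ₀ * (1 + τ) + 4 * δ) * γop ≤ θp) (hκθw : 2 * κ₀ * (1 + τ) * γop + 4 * δ ≤ θp)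
    (hstab : ∀ φ : EuclideanSpace ℝ ι, -(κ₀ * ∑ x ∈ Y, φ x ^ 2) ≤ U φ)
    (hU'b : ∀ φ : EuclideanSpace ℝ ι, ‖U' φ‖ ≤ κ₁ * (a + ∑ x ∈ Y, φ x ^ 2)) (hU''b : ∀ φ : EuclideanSpace ℝ ι, ‖U'' φ‖ ≤ κ₂)
    (hU₃b : ∀ φ : EuclideanSpace ℝ ι, ‖U₃ φ‖ ≤ κ₃) (hU₄b : ∀ φ : EuclideanSpace ℝ ι, ‖U₄ φ‖ ≤ κ₄) (hlam : 0 ≤ lam)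
    (hUsec : ∀ s : ℝ, 0 ≤ s → s ≤ 1 → ∀ a b : EuclideanSpace ℝ ι,
      U ((1 - s) • a + s • b) - lam / 2 * (s * (1 - s)) * ∑ i, (a i - b i) ^ 2 ≤ (1 - s) * U a + s * U b)
    (hρg : lam * γop < 1)
    -- the entrywise majorants of orders two, three, four
    (hHk : ∀ (φ : EuclideanSpace ℝ ι) (x z : ι), |U'' φ (EuclideanSpace.single z (1 : ℝ)) (EuclideanSpace.single x (1 : ℝ))| ≤ Hk x z)
    (hHk0 : ∀ v u, 0 ≤ Hk v u)
    (hK3 : ∀ (φ : EuclideanSpace ℝ ι) (u x y : ι),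
      |U₃ φ (EuclideanSpace.single u (1 : ℝ)) (EuclideanSpace.single x (1 : ℝ)) (EuclideanSpace.single y (1 : ℝ))| ≤ K3 x y u)
    (hK30 : ∀ x y u, 0 ≤ K3 x y u)
    (hK4 : ∀ (φ : EuclideanSpace ℝ ι) (u x y z : ι), |U₄ φ (EuclideanSpace.single u (1 : ℝ)) (EuclideanSpace.single x (1 : ℝ))
      (EuclideanSpace.single y (1 : ℝ)) (EuclideanSpace.single z (1 : ℝ))| ≤ K4 x y z u)
    (hhr : ∀ v, ∑ u, Hk v u ≤ hr)
    -- the factor's letters and the smallness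
    (ψ : EuclideanSpace ℝ ι) (hαr : ∀ u, ∑ w, |A u w| ≤ αr) (hαc : ∀ w, ∑ u, |A u w| ≤ αc)
    (hlamA : ∀ x : κ, ∑ u, ∑ v, |A u x| * |A v x| * Hk v u ≤ lamA) (hlamA1 : lamA < 1) (hγ : αc * hr * αr / (1 - lamA) ≤ γ) (hγ1 : γ < 1)
    -- the admissible `D` with weighted letters, the weights `θ, σ, ρ, r`, the weighted profiles
    (hD : ∀ x y, 0 ≤ D x y)
    (hDC : ∀ x y, (if x = y then (1 : ℝ) else 0) + ∑ z, D x z * ((if y = z then 0 else ∑ u, ∑ v, |A u y| * |A v z| * Hk v u) / (1 - lamA)) ≤ D x y)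
    (hθnn : ∀ z w, 0 ≤ θ z w) (hDθr : ∀ z, ∑ w, D z w * θ z w ≤ dθ) (hdθ : 0 ≤ dθ) (hDθc : ∀ w, ∑ z, D z w * θ z w ≤ dθ') (hdθ' : 0 ≤ dθ')
    (hσ0 : ∀ x w, 0 ≤ σ x w) (hσθ : ∀ x z w, σ x w ≤ σ x z * θ z w)
    (hρ1 : ∀ x y, 1 ≤ ρ x y) (hρsymm : ∀ x y, ρ x y = ρ y x) (hρmul : ∀ x y z, ρ x z ≤ ρ x y * ρ y z) (hρσ : ∀ x y w, ρ x y ^ 8 ≤ σ x w * σ y w)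
    (hr1 : ∀ x y, 1 ≤ r x y) (hrσ : ∀ x y w, r x y ^ 24 ≤ σ x w * σ y w)
    (haσ : ∀ v : ι, ∑ w, (∑ u, |A u w| * Hk v u) * σ v w ≤ αθ) (hβ : 0 ≤ βθ) (haσ' : ∀ (v : ι) (w : κ), (∑ u, |A u w| * Hk v u) * σ v w ≤ βθ)
    (hgσ : ∀ x y : ι, ∑ w, (∑ u, |A u w| * K3 x y u) * σ x w ≤ αθ) (hgσ' : ∀ (x y : ι) (w : κ), (∑ u, |A u w| * K3 x y u) * σ x w ≤ βθ)
    (hK40 : ∀ x y z u, 0 ≤ K4 x y z u) (hhc : ∀ u, ∑ v, Hk v u ≤ hc)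
    (hk3r : ∀ x, ∑ y, ∑ u, K3 x y u ≤ k3r) (hk3c : ∀ u, ∑ y, ∑ z, K3 y z u ≤ k3c) (hk3m : ∀ y, ∑ x, ∑ u, K3 x y u ≤ k3m)
    (hk4c : ∀ u, ∑ y, ∑ z, ∑ t, K4 y z t u ≤ k4c) (hk4s2 : ∀ y, ∑ x, ∑ t, ∑ u, K4 x y t u ≤ k4s2) (hk4s3 : ∀ z, ∑ x, ∑ y, ∑ u, K4 x y z u ≤ k4s3)
    (hDr : ∀ z, ∑ w, D z w ≤ dr) (hDc : ∀ w, ∑ z, D z w ≤ dc) (hS : ∀ x, ∑ y, 1 / ρ x y ≤ S) (hrsymm : ∀ x y, r x y = r y x)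
    (hSr : ∀ u, ∑ v, (r u v ^ 2)⁻¹ ≤ S') (hn : ∀ b, (Finset.univ.filter (fun a => Hk a b ≠ 0)).card ≤ n)
    (hn' : ∀ a, (Finset.univ.filter (fun b => Hk a b ≠ 0)).card ≤ n)
    (hC3 : 0 ≤ 4 * Real.sqrt ((5 * ((κ₂ ^ 4 + κ₃ ^ 4) * γop ^ 2) / (1 - lam * γop) ^ 2) * (αθ * dθ * (βθ * dθ') / (1 - lamA))))
    (hC4 : 0 ≤ (4 * (αθ * dθ * (βθ * dθ') / (1 - lamA)) + 3 * (αθ * dθ * (βθ * dθ') / (1 - lamA)) ^ 2 + 4 * (5 * (κ₂ ^ 4 * γop ^ 2) / (1 - lam * γop)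
        ^ 2) + 4
          * (50 * (κ₂ ^ 6 * γop ^ 3) / (1 - lam * γop) ^ 3) + 2 * (((5 * (κ₂ ^ 4 * γop ^ 2) / (1 - lam * γop) ^ 2) + 1) / 2) * ((((5 * (κ₂ ^ 4 * γop
              ^ 2) / (1 - lam * γop) ^ 2) + 1) / 2) + (5 *
          (κ₂ ^ 4 * γop ^ 2) / (1 - lam * γop) ^ 2)))) :
    ‖(∑ x', ∑ y', ∑ z', (fderiv ℝ (fun ψ' : EuclideanSpace ℝ ι => ((∫ ω : EuclideanSpace ℝ ι, exp (-U (ω + ψ')) ∂(multivariateGaussian 0 (A *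
        Aᵀ))))⁻¹ * (∫ ω : EuclideanSpace ℝ ι, exp (-U (ω + ψ')) * (U₃ (ω + ψ') (EuclideanSpace.single x' (1 : ℝ)) (EuclideanSpace.single y' (1 : ℝ))
        (EuclideanSpace.single z' (1 : ℝ)) - U' (ω + ψ') (EuclideanSpace.single y' (1 : ℝ)) * U'' (ω + ψ') (EuclideanSpace.single x' (1 : ℝ))
        (EuclideanSpace.single z' (1 : ℝ)) - U'' (ω + ψ') (EuclideanSpace.single x' (1 : ℝ)) (EuclideanSpace.single y' (1 : ℝ)) * U' (ω + ψ')
        (EuclideanSpace.single z' (1 : ℝ)) - U' (ω + ψ') (EuclideanSpace.single x' (1 : ℝ)) * U'' (ω + ψ') (EuclideanSpace.single y' (1 : ℝ))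
        (EuclideanSpace.single z' (1 : ℝ)) + U' (ω + ψ') (EuclideanSpace.single x' (1 : ℝ)) * U' (ω + ψ') (EuclideanSpace.single y' (1 : ℝ)) * U' (ω
        + ψ') (EuclideanSpace.single z' (1 : ℝ))) ∂(multivariateGaussian 0 (A * Aᵀ))) + ((∫ ω : EuclideanSpace ℝ ι, exp (-U (ω + ψ'))
        ∂(multivariateGaussian 0 (A * Aᵀ))) ^ 2)⁻¹ * (∫ ω : EuclideanSpace ℝ ι, exp (-U (ω + ψ')) * U' (ω + ψ') (EuclideanSpace.single x' (1 : ℝ))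
        ∂(multivariateGaussian 0 (A * Aᵀ))) * (∫ ω : EuclideanSpace ℝ ι, exp (-U (ω + ψ')) * (U'' (ω + ψ') (EuclideanSpace.single y' (1 : ℝ))
        (EuclideanSpace.single z' (1 : ℝ)) - U' (ω + ψ') (EuclideanSpace.single y' (1 : ℝ)) * U' (ω + ψ') (EuclideanSpace.single z' (1 : ℝ)))
        ∂(multivariateGaussian 0 (A * Aᵀ))) + ((∫ ω : EuclideanSpace ℝ ι, exp (-U (ω + ψ')) ∂(multivariateGaussian 0 (A * Aᵀ))) ^ 2)⁻¹ * (∫ ω :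
        EuclideanSpace ℝ ι, exp (-U (ω + ψ')) * U' (ω + ψ') (EuclideanSpace.single y' (1 : ℝ)) ∂(multivariateGaussian 0 (A * Aᵀ))) * (∫ ω :
        EuclideanSpace ℝ ι, exp (-U (ω + ψ')) * (U'' (ω + ψ') (EuclideanSpace.single x' (1 : ℝ)) (EuclideanSpace.single z' (1 : ℝ)) - U' (ω + ψ')
        (EuclideanSpace.single x' (1 : ℝ)) * U' (ω + ψ') (EuclideanSpace.single z' (1 : ℝ))) ∂(multivariateGaussian 0 (A * Aᵀ))) +
      (((∫ ω : EuclideanSpace ℝ ι, exp (-U (ω + ψ')) ∂(multivariateGaussian 0 (A * Aᵀ))) ^ 2)⁻¹ * (∫ ω : EuclideanSpace ℝ ι, exp (-U (ω + ψ')) * (U''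
          (ω + ψ') (EuclideanSpace.single x' (1 : ℝ)) (EuclideanSpace.single y' (1 : ℝ)) - U' (ω + ψ') (EuclideanSpace.single x' (1 : ℝ)) * U' (ω +
          ψ') (EuclideanSpace.single y' (1 : ℝ))) ∂(multivariateGaussian 0 (A * Aᵀ))) + -2 / (∫ ω : EuclideanSpace ℝ ι, exp (-U (ω + ψ'))
          ∂(multivariateGaussian 0 (A * Aᵀ))) ^ 3 * -(∫ ω : EuclideanSpace ℝ ι, exp (-U (ω + ψ')) * U' (ω + ψ') (EuclideanSpace.single x' (1 : ℝ))
          ∂(multivariateGaussian 0 (A * Aᵀ))) * (∫ ω : EuclideanSpace ℝ ι, exp (-U (ω + ψ')) * U' (ω + ψ') (EuclideanSpace.single y' (1 : ℝ))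
          ∂(multivariateGaussian 0 (A * Aᵀ)))) * (∫ ω : EuclideanSpace ℝ ι, exp (-U (ω + ψ')) * U' (ω + ψ') (EuclideanSpace.single z' (1 : ℝ))
          ∂(multivariateGaussian 0 (A * Aᵀ)))) ψ).smulRight
      ((EuclideanSpace.proj x' : EuclideanSpace ℝ ι →L[ℝ] ℝ).smulRight ((EuclideanSpace.proj y' : EuclideanSpace ℝ ι →L[ℝ] ℝ).smulRight
          (EuclideanSpace.proj z' : EuclideanSpace ℝ ι →L[ℝ] ℝ))))‖ ≤
      Real.sqrt ((k4s2 + (2 * (αr * k4s2 * (αc * hc)) + hr * αr * (αc * k4c) + αr * k4s3 * (αc * hc) + αr * k3r * (αc * k3c) + 2 * (αr * k3m * (αc *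
          k3c))) *
        dr * dc / (1 - lamA) + 6 * ((n : ℝ) * ((4 * Real.sqrt ((5 * ((κ₂ ^ 4 + κ₃ ^ 4) * γop ^ 2) / (1 - lam * γop) ^ 2) * (αθ * dθ * (βθ * dθ') / (1
            - lamA)))) * S ^ 2)) + (4 * (αθ * dθ * (βθ * dθ') / (1 - lamA)) + 3 * (αθ * dθ * (βθ * dθ') / (1 - lamA)) ^ 2 + 4 * (5 * (κ₂ ^ 4 * γop ^
            2) / (1 - lam * γop) ^ 2) + 4
          * (50 * (κ₂ ^ 6 * γop ^ 3) / (1 - lam * γop) ^ 3) + 2 * (((5 * (κ₂ ^ 4 * γop ^ 2) / (1 - lam * γop) ^ 2) + 1) / 2) * ((((5 * (κ₂ ^ 4 * γop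
              ^ 2) / (1 - lam * γop) ^ 2) + 1) / 2) + (5 *
          (κ₂ ^ 4 * γop ^ 2) / (1 - lam * γop) ^ 2))) * (16 * S' ^ 3)) *
        (k4s3 + (2 * (αr * k4s3 * (αc * hc)) + hr * αr * (αc * k4c) + αr * k4s3 * (αc * hc) + 3 * (αr * k3m * (αc * k3c))) * dr * dc / (1 - lamA) +
        6 * ((n : ℝ) * ((4 * Real.sqrt ((5 * ((κ₂ ^ 4 + κ₃ ^ 4) * γop ^ 2) / (1 - lam * γop) ^ 2) * (αθ * dθ * (βθ * dθ') / (1 - lamA)))) * S ^ 2)) +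
            (4 * (αθ * dθ * (βθ * dθ') / (1 - lamA)) + 3 * (αθ * dθ * (βθ * dθ') / (1 - lamA)) ^ 2 + 4 * (5 * (κ₂ ^ 4 * γop ^ 2) / (1 - lam * γop) ^
            2) + 4
          * (50 * (κ₂ ^ 6 * γop ^ 3) / (1 - lam * γop) ^ 3) + 2 * (((5 * (κ₂ ^ 4 * γop ^ 2) / (1 - lam * γop) ^ 2) + 1) / 2) * ((((5 * (κ₂ ^ 4 * γop
              ^ 2) / (1 - lam * γop) ^ 2) + 1) / 2) + (5 *
          (κ₂ ^ 4 * γop ^ 2) / (1 - lam * γop) ^ 2))) * (16 * S' ^ 3))) := by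
  have hΓ : (A * Aᵀ).PosSemidef := posSemidef_AAT A
  have hl1 : 0 < 1 - lamA := by linarith
  refine opNorm_le_of_slot_letters_four _ (fun z => ?_) (fun t => ?_)
  · refine le_trans (Finset.sum_le_sum fun x _ => Finset.sum_le_sum fun y _ => Finset.sum_le_sum fun t _ => ?_)
      (output_k4s2 hK40 hK30 hHk0 hαr hαc hhr hhc hk3r hk3c hk3m hk4c hk4s2 hk4s3 hρsymm hn hn' hrsymm hSr hlamA1 hD hDr hDc hC3 hC4 hρ1 hS z)
    rw [third_form_clm_fderiv_entry hΓ hΓop Y hUd hU'd hU''d hU₃d hU₄c hκ₀ hκ₁ ha hτ hδ hθ1 hκθ hstab hU'b hθ0 hU''b hU₃b hU₄b ψ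
        (EuclideanSpace.single x (1 : ℝ)) y z t]
    exact whitened_fourth_kernel_entry hΓop Y hUd hU'd hU''d hU₃d hU₄c hκ₀ hκ₁ ha hτ hδ hθ0 hθ1 hκθ hκθw hstab hU'b hU''b hU₃b hU₄b hlam hUsec hρg
        hHk hHk0 hK3 hK30 hK4 hhr ψ hαr hαc hlamA hlamA1 hγ hγ1 hD hDC hθnn hDθr hdθ hDθc hdθ' hσ0 hσθ hρ1 hρsymm hρmul hρσ hr1 hrσ haσ hβ haσ' hgσ
        hgσ' x y z t
  · refine le_trans (Finset.sum_le_sum fun x _ => Finset.sum_le_sum fun y _ => Finset.sum_le_sum fun z _ => ?_)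
      (output_k4s3 hK40 hK30 hHk0 hαr hαc hhr hhc hk3c hk3m hk4c hk4s3 hρsymm hn hn' hrsymm hSr hlamA1 hD hDr hDc hC3 hC4 hρ1 hS t)
    rw [third_form_clm_fderiv_entry hΓ hΓop Y hUd hU'd hU''d hU₃d hU₄c hκ₀ hκ₁ ha hτ hδ hθ1 hκθ hstab hU'b hθ0 hU''b hU₃b hU₄b ψ
        (EuclideanSpace.single x (1 : ℝ)) y z t]
    exact whitened_fourth_kernel_entry hΓop Y hUd hU'd hU''d hU₃d hU₄c hκ₀ hκ₁ ha hτ hδ hθ0 hθ1 hκθ hκθw hstab hU'b hU''b hU₃b hU₄b hlam hUsec hρg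
        hHk hHk0 hK3 hK30 hK4 hhr ψ hαr hαc hlamA hlamA1 hγ hγ1 hD hDC hθnn hDθr hdθ hDθc hdθ' hσ0 hσθ hρ1 hρsymm hρmul hρσ hr1 hrσ haσ hβ haσ' hgσ
        hgσ' x y z t

end TheEnd

/-! ## §2. Toy -/

/-- Toy (the shape of the letter): equal slot letters `L` give `√(L·L) = L` for `L ≥ 0`. -/
example (L : ℝ) (hL : 0 ≤ L) : Real.sqrt (L * L) = L := Real.sqrt_mul_self hL

end Summit.QuantumFields.BalabanUV.T4Continuum.NE7b.SupFourthOrderOperatorLetter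

end
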